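import Summits.RiemannHypothesis.RiemannHypothesis.Theorems.WeilFormatCCinfImageGlue
import Summits.RiemannHypothesis.RiemannHypothesis.Theorems.WeilFormatCCinfBlockEntries
import Summits.RiemannHypothesis.RiemannHypothesis.Theorems.WeilFormatCPolyWindowMixedIncrement
import Summits.RiemannHypothesis.RiemannHypothesis.Theorems.WeilFormatCPolyWindowEntryBox
import Summits.RiemannHypothesis.RiemannHypothesis.Theorems.WeilFormatCCinfVTableCoeffBox
import Literature.NumberTheory.LFunctions.YoshidaWindowGramColumnData
import HarnessLib

/-!
# Format C, design C∞ (E2, data side): the MIXED-TABLE and PROFILE-BLOCK primitives — entry boxes of `X⁺_j(m)`, `X⁻_j(m)`, `Pf`, `Ip` and their packed claims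

Route context: Fourier–Galerkin / Schur-complement certificates of Weil positivity on a window ("format C", C∞ door
`weilPositivityOn_of_cinf_cert`, `WeilFormatCCinfDoorCert`; supporting stmt-RiemannHypothesis-0098; seat rh-explicit-weil-2,
cell memos `…/rh-explicit-weil-2/gen16/E2F-CERT-PIPELINE.md` §2 (primitives XL/XM/XMT) and `E2F-EMITTER-SPEC.md` §5).

The exact-integer stages consume the door's mixed tables (profile against the sector bases)
`X⁺_j(m) = Re W_a(1 f_j, w⁺_m)/d_m` (`d_0 = 1`, `d_m = √2`), `X⁻_j(m) = Im W_a(1 f_j, w⁻_{m+1})/√2`, `f_j = Σ_q c_{jq} x^q`, as CLAIMED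
packed tables.  By the landed reductions (`re_weilWindowSesq_indicator_poly_chiEven_div`, `im_weilWindowSesq_indicator_poly_chiOdd_div`
of `WeilFormatCCinfImageGlue`; `re_weilWindowSesq_indicator_poly_chiEven_zero` of `WeilFormatCCinfBlockEntries`; `weilWindowSesq_chi_zero_right`
of `WeilFormatCPolyWindowMixedIncrement`; `WinEntry.weilWindowSesq_indicator_pow_eq_entryVal`) every entry is a short rational combination of the
MONOMIAL tables format C already certifies: the mixed monomial table `mtab[m][q] ∋ W_a(1x^q, χ_m)` (`WinGlue.mem_of_checkMixedTable`,
`1 ≤ m ≤ N`, `q ≤ P`) and the profile-block table `etab[q][k] ∋ E_{qk} = W_a(1x^q, 1x^k)` (`WinGlue.mem_of_checkEntryTable`).  This file takes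
those two conclusions as HYPOTHESES (`MixedTabNear`, `EntryTabNear`) and provides:

* `CinfPrimX.evenXBox` / `oddXBox` — per-entry interval evaluators; ★ `mem_evenXBox`, ★ `mem_oddXBox` — they enclose the door's PRINTED
  mixed-table entries (coefficients `((c_{jq} : ℚ) : ℝ)`, powers `s = sl.toFinset ⊆ [0, P]`);
* ★ `xDataNear_even/odd`, ★ `xDataNearT_even/odd` — the packed claims in both layouts
  (`(j, t) ↦ X^±_j(m₀ + t)` and transposed), ready for `CinfPacked.TabNear.of_dataNear` (`WeilFormatCCinfCertPacked`);
* the `r × r` PROFILE BLOCK: `pfBox` / ★ `mem_pfBox` (`Pf(j₁,j₂) = Re W_a(1f_{j₁}, 1f_{j₂}) = Σ_q Σ_q' c c' E_{qq'}`, by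
  `weilWindowSesq_indicator_poly_real`) and the EXACT rational `L²` Gram entries `ipQ` / `re_integral_indicator_poly_mul_conj` / `ipBox` /
  ★ `mem_ipBox` (`Ip(j₀,j₁) = Re ∫ 1f_{j₀} · conj(1f_{j₁}) = Σ_q Σ_q' c c' (a^{q+q'+1} − (−a)^{q+q'+1})/(q+q'+1)`), with packed claims
  ★ `pfDataNear`, ★ `ipDataNear`.

Bookkeeping over landed evaluators; standard axioms; no RH claim.
-/

set_option autoImplicit false
-- `Summit.RiemannHypothesis.RiemannHypothesis.…` is the layout-mandated namespace (summit = problem name).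
set_option linter.dupNamespace false

open Complex Set Finset
open scoped Real ComplexConjugate

namespace Summit.RiemannHypothesis.RiemannHypothesis.Theorems.WeilFormatC

namespace CinfPrimX

open Literature.NumberTheory.LFunctions Literature.NumberTheory.LFunctions.Yoshida1992
open Literature.Analysis.ValidatedNumerics Literature.Analysis.ValidatedNumerics.NumericsMP
open WinConst (mulRatBox mem_mulRatBox)
open WinEntry (entryVal weilWindowSesq_indicator_pow_eq_entryVal)
open CinfCoeff (sumList mem_sumList)

variable {S : ℕ}

/-! ## The two certified monomial tables, as hypotheses -/

/-- The mixed monomial table: `mtab[m][q] ∋ W_a(1x^q, χ_m)` for `1 ≤ m ≤ N`, `q ≤ P` (the conclusion of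
`WinGlue.mem_of_checkMixedTable`). -/
structure MixedTabNear (S : ℕ) (a : ℝ) (N P : ℕ) (mtab : List (List MC)) : Prop where
  /-- the entrywise enclosure -/
  out : ∀ m, 1 ≤ m → m ≤ N → ∀ q ≤ P, MC.mem S (weilWindowSesq a ((Icc (-a) a).indicator fun x : ℝ ↦ ((x : ℂ)) ^ q)
    (Yoshida1992.chi a (m : ℤ))) ((mtab.getD m []).getD q default)

/-- The profile-block monomial table: `etab[q][k] ∋ E_{qk}` for `q, k ≤ P` (the conclusion of `WinGlue.mem_of_checkEntryTable`). -/
structure EntryTabNear (S : ℕ) (a : ℝ) (P : ℕ) (etab : List (List MI)) : Prop where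
  /-- the entrywise enclosure -/
  out : ∀ q k, q ≤ P → k ≤ P → MI.mem S (entryVal a q k) ((etab.getD q []).getD k default)

/-! ## The entry evaluators -/

/-- **Even mixed-table entry box** at mode `m`: `m = 0`: `Σ_q c_q · E_{q0} · Rs`; `m ≠ 0`: `Σ_q c_q (1 + (−1)^q)/2 · Re mtab[m][q]`. -/
def evenXBox (S : ℕ) (Rs : MI) (mtab : List (List MC)) (etab : List (List MI)) (c : ℕ → ℚ) (sl : List ℕ) (m : ℕ) : MI :=
  if m = 0 then sumList S (fun q ↦ mulRatBox (((etab.getD q []).getD 0 default).mul S Rs) (c q)) sl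
  else sumList S (fun q ↦ mulRatBox ((mtab.getD m []).getD q default).re (c q * ((1 + (-1) ^ q) / 2))) sl

/-- **Odd mixed-table entry box** at kernel index `m` (mode `m + 1`): `Σ_q c_q (1 − (−1)^q)/2 · Im mtab[m+1][q]`. -/
def oddXBox (S : ℕ) (mtab : List (List MC)) (c : ℕ → ℚ) (sl : List ℕ) (m : ℕ) : MI :=
  sumList S (fun q ↦ mulRatBox ((mtab.getD (m + 1) []).getD q default).im (c q * ((1 - (-1) ^ q) / 2))) sl

/-- A list-indexed sum of boxes encloses the `toFinset`-sum when every LISTED term is enclosed (membership-restricted variant of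
`CinfCoeff.mem_sumList`). -/
private theorem mem_sumList_of {F : ℕ → MI} {g : ℕ → ℝ} :
    ∀ (l : List ℕ), l.Nodup → (∀ q ∈ l, MI.mem S (g q) (F q)) → MI.mem S (∑ q ∈ l.toFinset, g q) (sumList S F l)
  | [], _, _ => by simpa [CinfCoeff.sumList] using MI.mem_ofInt S 0
  | q :: l, hnd, h => by
    rw [List.nodup_cons] at hnd
    rw [List.toFinset_cons, Finset.sum_insert (by simpa using hnd.1), CinfCoeff.sumList]
    exact MI.mem_add (h q (by simp)) (mem_sumList_of l hnd.2 fun q' hq' ↦ h q' (by simp [hq']))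

variable {a : ℚ} {Rs : MI} {N P : ℕ} {mtab : List (List MC)} {etab : List (List MI)}

/-- ★ **`evenXBox ∋ X⁺(m)`** — the door's printed even mixed entry `Re W_a(1_{[-a,a]} Σ_{q∈sl} c_q x^q, w⁺_m)/(m = 0 ? 1 : √2)`
(`m ≤ N`, `sl ⊆ [0, P]` without duplicates). -/
theorem mem_evenXBox (hS : 0 < S) (ha : 0 < a) (hRs : MI.mem S (1 / Real.sqrt (2 * (a : ℝ))) Rs)
    (hmt : MixedTabNear S (a : ℝ) N P mtab) (het : EntryTabNear S (a : ℝ) P etab) (c : ℕ → ℚ) {sl : List ℕ}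
    (hsl : sl.Nodup) (hP : ∀ q ∈ sl, q ≤ P) {m : ℕ} (hmN : m ≤ N) :
    MI.mem S
      ((weilWindowSesq (a : ℝ) ((Icc (-(a : ℝ)) (a : ℝ)).indicator fun x : ℝ ↦
          ∑ q ∈ sl.toFinset, ((((c q : ℚ) : ℝ) : ℝ) : ℂ) * ((x : ℂ)) ^ q) (chiEven (a : ℝ) m)).re
        / (if m = 0 then 1 else Real.sqrt 2))
      (evenXBox S Rs mtab etab c sl m) := by
  have ha' : (0 : ℝ) < (a : ℝ) := by exact_mod_cast ha
  by_cases hm : m = 0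
  · subst hm
    rw [if_pos rfl, div_one, re_weilWindowSesq_indicator_poly_chiEven_zero ha' sl.toFinset (fun q ↦ ((c q : ℚ) : ℝ)),
      evenXBox, if_pos rfl]
    refine mem_sumList_of sl hsl fun q hq ↦ ?_
    have e : (weilWindowSesq (a : ℝ) ((Icc (-(a : ℝ)) (a : ℝ)).indicator fun x : ℝ ↦ ((x : ℂ)) ^ q)
        (Yoshida1992.chi (a : ℝ) 0)).re = entryVal (a : ℝ) q 0 * (1 / Real.sqrt (2 * (a : ℝ))) := by
      rw [weilWindowSesq_chi_zero_right, weilWindowSesq_indicator_pow_eq_entryVal ha', ← Complex.ofReal_mul,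
        Complex.ofReal_re, mul_comm]
    have h1 := mem_mulRatBox (MI.mem_mul hS (het.out q 0 (hP q hq) (Nat.zero_le _)) hRs) (c q)
    rw [e]
    convert h1 using 1
    ring
  · rw [if_neg hm, re_weilWindowSesq_indicator_poly_chiEven_div ha' sl.toFinset (fun q ↦ ((c q : ℚ) : ℝ)) hm,
      evenXBox, if_neg hm]
    refine mem_sumList_of sl hsl fun q hq ↦ ?_
    have h1 := mem_mulRatBox (hmt.out m (Nat.pos_of_ne_zero hm) hmN q (hP q hq)).1 (c q * ((1 + (-1) ^ q) / 2))
    convert h1 using 1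
    push_cast
    ring

/-- ★ **`oddXBox ∋ X⁻(m)`** — the door's printed odd mixed entry `Im W_a(1_{[-a,a]} Σ_{q∈sl} c_q x^q, w⁻_{m+1})/√2` (`m + 1 ≤ N`). -/
theorem mem_oddXBox (ha : 0 < a) (hmt : MixedTabNear S (a : ℝ) N P mtab) (c : ℕ → ℚ) {sl : List ℕ} (hsl : sl.Nodup)
    (hP : ∀ q ∈ sl, q ≤ P) {m : ℕ} (hmN : m + 1 ≤ N) :
    MI.mem S
      ((weilWindowSesq (a : ℝ) ((Icc (-(a : ℝ)) (a : ℝ)).indicator fun x : ℝ ↦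
          ∑ q ∈ sl.toFinset, ((((c q : ℚ) : ℝ) : ℝ) : ℂ) * ((x : ℂ)) ^ q) (chiOdd (a : ℝ) (m + 1))).im / Real.sqrt 2)
      (oddXBox S mtab c sl m) := by
  have ha' : (0 : ℝ) < (a : ℝ) := by exact_mod_cast ha
  rw [im_weilWindowSesq_indicator_poly_chiOdd_div ha' sl.toFinset (fun q ↦ ((c q : ℚ) : ℝ)) (m + 1), oddXBox]
  refine mem_sumList_of sl hsl fun q hq ↦ ?_
  have h1 := mem_mulRatBox (hmt.out (m + 1) (Nat.succ_pos m) hmN q (hP q hq)).2 (c q * ((1 - (-1) ^ q) / 2))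
  convert h1 using 1
  push_cast
  ring

/-! ## Packed claims of the mixed tables -/

/-- Local copy of `CinfPrimV.dataNear_of_checkRect` (`WeilFormatCCinfCertPrimV`, landed; no farm olean at filing time):
any evaluator with `f i t ∈ box i t` for `i < n`, `t < K` and one passing `Encl.checkRect` give `Encl.DataNear f n K w o c ρ XP`. -/
private theorem dataNear_of_checkRect (hS : 0 < S) {f : ℕ → ℕ → ℝ} {box : ℕ → ℕ → MI} {n K w o c ρ : ℕ} {XP : List ℕ}
    (hbox : ∀ i < n, ∀ t < K, MI.mem S (f i t) (box i t))
    (h : Encl.checkRect S c (ρ : ℤ) w K o box XP 0 n 0 K = true) : Encl.DataNear f n K w o c ρ XP := by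
  have h0 : Encl.DataNear f (0 + n) K w o c ρ XP :=
    Encl.DataNear.extendRows Encl.DataNear.zeroRows fun i _ hi t ht ↦ by
      have h2 := Encl.near_of_checkRect hS (f := f)
        (fun i _ hi t _ ht ↦ hbox i (by simpa using hi) t (by simpa using ht)) h (Nat.zero_le i) hi
        (Nat.zero_le t) (by simpa using ht)
      exact_mod_cast h2
  simpa using h0

/-- ★ **Packed claim of the even mixed table**, layout `(j, t) ↦ X⁺_j(m₀ + t)` (rows `j < r`; needs `m₀ + K ≤ N + 1`). -/
theorem xDataNear_even (hS : 0 < S) (ha : 0 < a) (hRs : MI.mem S (1 / Real.sqrt (2 * (a : ℝ))) Rs)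
    (hmt : MixedTabNear S (a : ℝ) N P mtab) (het : EntryTabNear S (a : ℝ) P etab) (c : ℕ → ℕ → ℚ) {sl : List ℕ}
    (hsl : sl.Nodup) (hP : ∀ q ∈ sl, q ≤ P) (m₀ : ℕ) {r K w o cc ρ : ℕ} (hK : m₀ + K ≤ N + 1) {XP : List ℕ}
    (h : Encl.checkRect S cc (ρ : ℤ) w K o (fun j t ↦ evenXBox S Rs mtab etab (c j) sl (m₀ + t)) XP 0 r 0 K = true) :
    Encl.DataNear (fun j t ↦ (weilWindowSesq (a : ℝ) ((Icc (-(a : ℝ)) (a : ℝ)).indicator fun x : ℝ ↦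
          ∑ q ∈ sl.toFinset, ((((c j q : ℚ) : ℝ) : ℝ) : ℂ) * ((x : ℂ)) ^ q) (chiEven (a : ℝ) (m₀ + t))).re
        / (if m₀ + t = 0 then 1 else Real.sqrt 2)) r K w o cc ρ XP :=
  dataNear_of_checkRect hS (fun j _ t ht ↦ mem_evenXBox hS ha hRs hmt het (c j) hsl hP (by omega)) h

/-- ★ **Packed claim of the even mixed table, TRANSPOSED layout** `(t, j) ↦ X⁺_j(m₀ + t)`. -/
theorem xDataNearT_even (hS : 0 < S) (ha : 0 < a) (hRs : MI.mem S (1 / Real.sqrt (2 * (a : ℝ))) Rs)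
    (hmt : MixedTabNear S (a : ℝ) N P mtab) (het : EntryTabNear S (a : ℝ) P etab) (c : ℕ → ℕ → ℚ) {sl : List ℕ}
    (hsl : sl.Nodup) (hP : ∀ q ∈ sl, q ≤ P) (m₀ : ℕ) {r K w o cc ρ : ℕ} (hK : m₀ + K ≤ N + 1) {XP : List ℕ}
    (h : Encl.checkRect S cc (ρ : ℤ) w r o (fun t j ↦ evenXBox S Rs mtab etab (c j) sl (m₀ + t)) XP 0 K 0 r = true) :
    Encl.DataNear (fun t j ↦ (weilWindowSesq (a : ℝ) ((Icc (-(a : ℝ)) (a : ℝ)).indicator fun x : ℝ ↦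
          ∑ q ∈ sl.toFinset, ((((c j q : ℚ) : ℝ) : ℝ) : ℂ) * ((x : ℂ)) ^ q) (chiEven (a : ℝ) (m₀ + t))).re
        / (if m₀ + t = 0 then 1 else Real.sqrt 2)) K r w o cc ρ XP :=
  dataNear_of_checkRect hS (fun t ht j _ ↦ mem_evenXBox hS ha hRs hmt het (c j) hsl hP (by omega)) h

/-- ★ **Packed claim of the odd mixed table**, layout `(j, t) ↦ X⁻_j(m₀ + t)` (kernel index; needs `m₀ + K ≤ N`). -/
theorem xDataNear_odd (hS : 0 < S) (ha : 0 < a) (hmt : MixedTabNear S (a : ℝ) N P mtab) (c : ℕ → ℕ → ℚ)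
    {sl : List ℕ} (hsl : sl.Nodup) (hP : ∀ q ∈ sl, q ≤ P) (m₀ : ℕ) {r K w o cc ρ : ℕ} (hK : m₀ + K ≤ N)
    {XP : List ℕ}
    (h : Encl.checkRect S cc (ρ : ℤ) w K o (fun j t ↦ oddXBox S mtab (c j) sl (m₀ + t)) XP 0 r 0 K = true) :
    Encl.DataNear (fun j t ↦ (weilWindowSesq (a : ℝ) ((Icc (-(a : ℝ)) (a : ℝ)).indicator fun x : ℝ ↦
          ∑ q ∈ sl.toFinset, ((((c j q : ℚ) : ℝ) : ℝ) : ℂ) * ((x : ℂ)) ^ q) (chiOdd (a : ℝ) (m₀ + t + 1))).im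
        / Real.sqrt 2) r K w o cc ρ XP :=
  dataNear_of_checkRect hS (fun j _ t ht ↦ mem_oddXBox ha hmt (c j) hsl hP (by omega)) h

/-- ★ **Packed claim of the odd mixed table, TRANSPOSED layout** `(t, j) ↦ X⁻_j(m₀ + t)`. -/
theorem xDataNearT_odd (hS : 0 < S) (ha : 0 < a) (hmt : MixedTabNear S (a : ℝ) N P mtab) (c : ℕ → ℕ → ℚ)
    {sl : List ℕ} (hsl : sl.Nodup) (hP : ∀ q ∈ sl, q ≤ P) (m₀ : ℕ) {r K w o cc ρ : ℕ} (hK : m₀ + K ≤ N)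
    {XP : List ℕ}
    (h : Encl.checkRect S cc (ρ : ℤ) w r o (fun t j ↦ oddXBox S mtab (c j) sl (m₀ + t)) XP 0 K 0 r = true) :
    Encl.DataNear (fun t j ↦ (weilWindowSesq (a : ℝ) ((Icc (-(a : ℝ)) (a : ℝ)).indicator fun x : ℝ ↦
          ∑ q ∈ sl.toFinset, ((((c j q : ℚ) : ℝ) : ℝ) : ℂ) * ((x : ℂ)) ^ q) (chiOdd (a : ℝ) (m₀ + t + 1))).im
        / Real.sqrt 2) K r w o cc ρ XP :=
  dataNear_of_checkRect hS (fun t ht j _ ↦ mem_oddXBox ha hmt (c j) hsl hP (by omega)) h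

/-! ## The profile block `Pf` and the `L²` Gram entries `Ip` (both `r × r`) -/

/-- **Profile-block entry box**: `Σ_{q∈sl} Σ_{q'∈sl} c_q d_{q'} · etab[q][q']`. -/
def pfBox (S : ℕ) (etab : List (List MI)) (c d : ℕ → ℚ) (sl : List ℕ) : MI :=
  sumList S (fun q ↦ sumList S (fun q' ↦ mulRatBox ((etab.getD q []).getD q' default) (c q * d q')) sl) sl

/-- ★ **`pfBox ∋ Pf`** — the door's printed profile-block entry `Re W_a(1_{[-a,a]} Σ_q c_q x^q, 1_{[-a,a]} Σ_q d_q x^q)`. -/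
theorem mem_pfBox (ha : 0 < a) (het : EntryTabNear S (a : ℝ) P etab) (c d : ℕ → ℚ) {sl : List ℕ} (hsl : sl.Nodup)
    (hP : ∀ q ∈ sl, q ≤ P) :
    MI.mem S
      (weilWindowSesq (a : ℝ)
        ((Icc (-(a : ℝ)) (a : ℝ)).indicator fun x : ℝ ↦ ∑ q ∈ sl.toFinset, ((((c q : ℚ) : ℝ) : ℝ) : ℂ) * ((x : ℂ)) ^ q)
        ((Icc (-(a : ℝ)) (a : ℝ)).indicator fun x : ℝ ↦ ∑ q ∈ sl.toFinset, ((((d q : ℚ) : ℝ) : ℝ) : ℂ) * ((x : ℂ)) ^ q)).re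
      (pfBox S etab c d sl) := by
  have ha' : (0 : ℝ) < (a : ℝ) := by exact_mod_cast ha
  rw [weilWindowSesq_indicator_poly_real ha' sl.toFinset sl.toFinset (fun q ↦ ((c q : ℚ) : ℝ)) (fun q ↦ ((d q : ℚ) : ℝ)),
    Complex.ofReal_re, pfBox]
  refine mem_sumList_of sl hsl fun q hq ↦ mem_sumList_of sl hsl fun q' hq' ↦ ?_
  have h1 := mem_mulRatBox (het.out q q' (hP q hq) (hP q' hq')) (c q * d q')
  rw [weilWindowSesq_indicator_pow_eq_entryVal ha', Complex.ofReal_re]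
  convert h1 using 1
  push_cast
  ring

/-- The rational `Σ_{q∈sl} Σ_{q'∈sl} c_q d_{q'} (a^{q+q'+1} − (−a)^{q+q'+1})/(q+q'+1)`. -/
def ipQ (c d : ℕ → ℚ) (a : ℚ) (sl : List ℕ) : ℚ :=
  (sl.map fun q ↦ (sl.map fun q' ↦ c q * d q' * ((a ^ (q + q' + 1) - (-a) ^ (q + q' + 1)) / (q + q' + 1))).sum).sum

/-- **The `L²` inner product of two real polynomial windows**:
`Re ∫ 1f · conj(1g) = Σ_q Σ_q' c_q d_{q'} (a^{q+q'+1} − (−a)^{q+q'+1})/(q+q'+1)` (`a ≥ 0`). -/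
theorem re_integral_indicator_poly_mul_conj {a : ℝ} (ha : 0 ≤ a) (s : Finset ℕ) (c d : ℕ → ℝ) :
    (∫ x, (Icc (-a) a).indicator (fun x : ℝ ↦ ∑ q ∈ s, ((c q : ℝ) : ℂ) * ((x : ℂ)) ^ q) x
        * conj ((Icc (-a) a).indicator (fun x : ℝ ↦ ∑ q ∈ s, ((d q : ℝ) : ℂ) * ((x : ℂ)) ^ q) x)).re
      = ∑ q ∈ s, ∑ q' ∈ s, c q * d q' * ((a ^ (q + q' + 1) - (-a) ^ (q + q' + 1)) / (q + q' + 1)) := by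
  rw [integral_indicator_mul_conj_indicator ha]
  have e : ∀ x : ℝ, (∑ q ∈ s, ((c q : ℝ) : ℂ) * ((x : ℂ)) ^ q) * conj (∑ q ∈ s, ((d q : ℝ) : ℂ) * ((x : ℂ)) ^ q)
      = ∑ q ∈ s, ∑ q' ∈ s, (((c q * d q' * x ^ (q + q') : ℝ)) : ℂ) := by
    intro x
    rw [map_sum, Finset.sum_mul_sum]
    refine Finset.sum_congr rfl fun q _ ↦ Finset.sum_congr rfl fun q' _ ↦ ?_
    rw [map_mul, Complex.conj_ofReal, map_pow, Complex.conj_ofReal]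
    push_cast
    ring
  simp_rw [e]
  rw [intervalIntegral.integral_finsetSum (fun q _ ↦ Continuous.intervalIntegrable (by fun_prop) _ _), Complex.re_sum]
  refine Finset.sum_congr rfl fun q _ ↦ ?_
  rw [intervalIntegral.integral_finsetSum (fun q' _ ↦ Continuous.intervalIntegrable (by fun_prop) _ _), Complex.re_sum]
  refine Finset.sum_congr rfl fun q' _ ↦ ?_
  rw [intervalIntegral.integral_ofReal, Complex.ofReal_re, intervalIntegral.integral_const_mul, integral_pow]
  push_cast
  ring

/-- Cast of `ipQ`. -/
theorem ipQ_cast (c d : ℕ → ℚ) (a : ℚ) {sl : List ℕ} (hsl : sl.Nodup) :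
    ((ipQ c d a sl : ℚ) : ℝ) = ∑ q ∈ sl.toFinset, ∑ q' ∈ sl.toFinset,
      ((c q : ℚ) : ℝ) * ((d q' : ℚ) : ℝ) * (((a : ℝ) ^ (q + q' + 1) - (-(a : ℝ)) ^ (q + q' + 1)) / (q + q' + 1)) := by
  rw [ipQ, List.sum_toFinset _ hsl, Rat.cast_list_sum, List.map_map]
  congr 1
  refine List.map_congr_left fun q _ ↦ ?_
  simp only [Function.comp_apply]
  rw [List.sum_toFinset _ hsl, Rat.cast_list_sum, List.map_map]
  congr 1
  refine List.map_congr_left fun q' _ ↦ ?_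
  simp only [Function.comp_apply]
  push_cast
  ring

/-- **`L²` Gram entry box**: the exact rational `ipQ` as a box. -/
def ipBox (S : ℕ) (c d : ℕ → ℚ) (a : ℚ) (sl : List ℕ) : MI := WinConst.ratBox S (ipQ c d a sl)

/-- ★ **`ipBox ∋ Ip`** — the door's printed `L²` Gram entry `Re ∫ 1f_{j₀} · conj(1f_{j₁})` of two real polynomial windows. -/
theorem mem_ipBox (ha : 0 < a) (c d : ℕ → ℚ) {sl : List ℕ} (hsl : sl.Nodup) :
    MI.mem S
      (∫ x, ((Icc (-(a : ℝ)) (a : ℝ)).indicator fun x : ℝ ↦ ∑ q ∈ sl.toFinset, ((((c q : ℚ) : ℝ) : ℝ) : ℂ) * ((x : ℂ)) ^ q) x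
        * conj (((Icc (-(a : ℝ)) (a : ℝ)).indicator fun x : ℝ ↦
          ∑ q ∈ sl.toFinset, ((((d q : ℚ) : ℝ) : ℝ) : ℂ) * ((x : ℂ)) ^ q) x)).re
      (ipBox S c d a sl) := by
  have ha' : (0 : ℝ) ≤ (a : ℝ) := by exact_mod_cast ha.le
  rw [re_integral_indicator_poly_mul_conj ha' sl.toFinset (fun q ↦ ((c q : ℚ) : ℝ)) (fun q ↦ ((d q : ℚ) : ℝ)),
    ← ipQ_cast c d a hsl, ipBox]
  exact WinConst.mem_ratBox S _

/-- ★ **Packed claim of the profile block** `(j₁, j₂) ↦ Pf(j₁, j₂)` (`r × r`, coefficient rows `c j`). -/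
theorem pfDataNear (hS : 0 < S) (ha : 0 < a) (het : EntryTabNear S (a : ℝ) P etab) (c : ℕ → ℕ → ℚ) {sl : List ℕ}
    (hsl : sl.Nodup) (hP : ∀ q ∈ sl, q ≤ P) {r w o cc ρ : ℕ} {XP : List ℕ}
    (h : Encl.checkRect S cc (ρ : ℤ) w r o (fun j₁ j₂ ↦ pfBox S etab (c j₁) (c j₂) sl) XP 0 r 0 r = true) :
    Encl.DataNear (fun j₁ j₂ ↦ (weilWindowSesq (a : ℝ)
        ((Icc (-(a : ℝ)) (a : ℝ)).indicator fun x : ℝ ↦ ∑ q ∈ sl.toFinset, ((((c j₁ q : ℚ) : ℝ) : ℝ) : ℂ) * ((x : ℂ)) ^ q)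
        ((Icc (-(a : ℝ)) (a : ℝ)).indicator fun x : ℝ ↦
          ∑ q ∈ sl.toFinset, ((((c j₂ q : ℚ) : ℝ) : ℝ) : ℂ) * ((x : ℂ)) ^ q)).re) r r w o cc ρ XP :=
  dataNear_of_checkRect hS (fun j₁ _ j₂ _ ↦ mem_pfBox ha het (c j₁) (c j₂) hsl hP) h

/-- ★ **Packed claim of the `L²` Gram block** `(j₀, j₁) ↦ Ip(j₀, j₁)` (`r × r`). -/
theorem ipDataNear (hS : 0 < S) (ha : 0 < a) (c : ℕ → ℕ → ℚ) {sl : List ℕ} (hsl : sl.Nodup) {r w o cc ρ : ℕ}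
    {XP : List ℕ} (h : Encl.checkRect S cc (ρ : ℤ) w r o (fun j₀ j₁ ↦ ipBox S (c j₀) (c j₁) a sl) XP 0 r 0 r = true) :
    Encl.DataNear (fun j₀ j₁ ↦ (∫ x, ((Icc (-(a : ℝ)) (a : ℝ)).indicator fun x : ℝ ↦
          ∑ q ∈ sl.toFinset, ((((c j₀ q : ℚ) : ℝ) : ℝ) : ℂ) * ((x : ℂ)) ^ q) x
        * conj (((Icc (-(a : ℝ)) (a : ℝ)).indicator fun x : ℝ ↦
          ∑ q ∈ sl.toFinset, ((((c j₁ q : ℚ) : ℝ) : ℝ) : ℂ) * ((x : ℂ)) ^ q) x)).re) r r w o cc ρ XP :=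
  dataNear_of_checkRect hS (fun j₀ _ j₁ _ ↦ mem_ipBox ha (c j₀) (c j₁) hsl) h

end CinfPrimX

end Summit.RiemannHypothesis.RiemannHypothesis.Theorems.WeilFormatC
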